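import Summits.ValiantsHypothesis.ValiantsHypothesis.Theorems.KPlusLogSqLawTropicalSymmetricOrbitThreeFourCore5
import Summits.ValiantsHypothesis.ValiantsHypothesis.Theorems.KPlusLogSqLawTropicalSymmetricThreeFourFifteenMirror

/-!
# Route «KPlusLogSqLaw» — the symmetric `(3,4)` tropical row in the ORBIT model: `T^orb_sym(3,4) ≤ 17` on every support (`TSymOrb34Le17`)

HONEST FRAMING.  Helper file (seat val-sym-lift-p2 (g6), cell `pub-symmetroid`, 2026-08-27; `--supports` the `WeakLifting` item
stmt-ValiantsHypothesis-19561 as a helper, no closure claim).  A SMALL-FORMAT kernel statement in the transpose-ORBIT carrier model of the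
cell (a term beats every present term outside its transpose orbit), far inside the known regime of the cruxes; port blueprint
`HOME/val-sym-lift-p2/g6/LEMMA-Z-liftp2g6.md` §5–§7; words pre-registered by the desk (R1732): «T^orb_sym(3,4) ≤ 17 on every support (kernel,
face-free, sign-free)».  Nothing here is about `TropicalB` / `WeakLifting` in their windows, Conjecture B, DoorA34 = `PosRootLawAt 3 4 18`
(OPEN, never asserted), `MatrixDescartes` (stmt-ValiantsHypothesis-18050) or VP ≠ VNP.  `TSymOrb34Le16` (the cell's value «≤ 16», which needs a
non-pairwise ingredient) stays a target and is NOT asserted; whether `17` is attained in the orbit model is not decided here.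

THIS FILE.  `mirror_elim` (the orbit-chain hypotheses are self-dual under rank reversal `x ↦ 3 − x` with the chain read backwards:
`hM ↔ hM`, `hR1 ↔ hR1'`, `hR2 ↔ hR2'`, `hR3 ↔ hR3'`), the face-free **`core17`** (nineteen pairwise distinct rank multisets are impossible: the
missed multiset is `{0,1,3}` ⇒ `orbV2`; `{0,2,3}` ⇒ mirrored `orbV2`; `{1,1,2}` ⇒ `core5`; `{1,2,2}` ⇒ mirrored `core5`; anything else ⇒ `orbY`),
and the kernel row **`tropRootLawAtSymmOrb_three_four_seventeen : TropRootLawAtSymmOrb 3 4 17`** = `tSymOrb34Le17_holds : TSymOrb34Le17`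
(sign-free: the alternation hypothesis is used only through injectivity of the rank multisets).
[cell statement R1732; folklore-level exchange arguments, no citation exists]
-/

set_option linter.dupNamespace false
set_option autoImplicit false

namespace Summit.ValiantsHypothesis.ValiantsHypothesis.Theorems.KPlusLogSqLaw

open Summit.ValiantsHypothesis.ValiantsHypothesis.Theorems.MatrixDescartes.Negative
open Summit.ValiantsHypothesis.ValiantsHypothesis.Theorems.LacunarySymmetroidMatrixDescartes
open Summit.ValiantsHypothesis.ValiantsHypothesis.Theorems.LacunarySymmetroidMatrixDescartes.TropicalCensus
open Finset

namespace SymmetricOrbitThreeFour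

open SymmetricThreeFour SymmetricThreeFourSeventeen SymmetricThreeFourSixteen SymmetricThreeFourFifteen

/-- **`mirror_elim`** (rank reversal).  The orbit-chain hypotheses for `(r, g)` imply the same hypotheses for the mirrored chain
`R k = (σ_(rev k), rev ∘ c_(rev k))` with the exponents `G x = Σg − g (rev x)`; so anything contradictory for every such `(R, G)` is
contradictory. [bookkeeping: `hM` is self-dual, `hR1 ↔ hR1'`, `hR2 ↔ hR2'`, `hR3 ↔ hR3'`] -/
theorem mirror_elim {n : ℕ} (r : Fin (n + 1) → Equiv.Perm (Fin 3) × (Fin 3 → Fin 4)) (g : Fin 4 → ℕ) (hmono : Monotone g)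
    (hshape : ∀ k, (r k).1 = 1 ∨ (∃ i j : Fin 3, i < j ∧ (r k).1 = Equiv.swap i j ∧ (r k).2 i = (r k).2 j) ∨ (∀ i, (r k).1 i ≠ i))
    (hM : ∀ a b : Fin (n + 1), a < b → ∀ l₁ l₂ : Fin 3,
      ((r a).1 l₁ = (r b).1 l₂ ∧ l₁ = l₂) ∨ ((r a).1 l₁ = l₂ ∧ (r b).1 l₂ = l₁) → (r a).2 l₁ ≤ (r b).2 l₂)
    (hR1 : ∀ a b : Fin (n + 1), a < b → (r a).1 = 1 → ∀ i j : Fin 3, i ≠ j → (r b).1 = Equiv.swap i j → (r b).2 i = (r b).2 j →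
      g ((r a).2 i) + g ((r a).2 j) < 2 * g ((r b).2 i))
    (hR1' : ∀ a b : Fin (n + 1), a < b → (r b).1 = 1 → ∀ i j : Fin 3, i ≠ j → (r a).1 = Equiv.swap i j → (r a).2 i = (r a).2 j →
      2 * g ((r a).2 i) < g ((r b).2 i) + g ((r b).2 j))
    (hR2 : ∀ a b : Fin (n + 1), a < b → ∀ i j k : Fin 3, i ≠ j → k ≠ i → k ≠ j → (r a).1 = Equiv.swap i j →
      (r a).2 i = (r a).2 j → (r b).1 i = j → (r b).1 j = k → (r b).1 k = i →
      g ((r a).2 k) + g ((r a).2 i) < g ((r b).2 j) + g ((r b).2 k))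
    (hR2' : ∀ a b : Fin (n + 1), a < b → ∀ i j k : Fin 3, i ≠ j → k ≠ i → k ≠ j → (r a).1 i = j → (r a).1 j = k → (r a).1 k = i →
      (r b).1 = Equiv.swap i j → (r b).2 i = (r b).2 j → g ((r a).2 j) + g ((r a).2 k) < g ((r b).2 k) + g ((r b).2 i))
    (hR3 : ∀ a b : Fin (n + 1), a < b → (r a).1 = 1 → ∀ i j k : Fin 3, i ≠ j → k ≠ i → k ≠ j →
      (r b).1 i = j → (r b).1 j = k → (r b).1 k = i → g ((r a).2 i) + g ((r a).2 j) < 2 * g ((r b).2 i))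
    (hR3' : ∀ a b : Fin (n + 1), a < b → (r b).1 = 1 → ∀ i j k : Fin 3, i ≠ j → k ≠ i → k ≠ j →
      (r a).1 i = j → (r a).1 j = k → (r a).1 k = i → 2 * g ((r a).2 i) < g ((r b).2 i) + g ((r b).2 j))
    (h : ∀ (R : Fin (n + 1) → Equiv.Perm (Fin 3) × (Fin 3 → Fin 4)) (G : Fin 4 → ℕ),
      (∀ k, R k = ((r k.rev).1, fun i => ((r k.rev).2 i).rev)) → Monotone G →
      (∀ k, (R k).1 = 1 ∨ (∃ i j : Fin 3, i < j ∧ (R k).1 = Equiv.swap i j ∧ (R k).2 i = (R k).2 j) ∨ (∀ i, (R k).1 i ≠ i)) →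
      (∀ a b : Fin (n + 1), a < b → ∀ l₁ l₂ : Fin 3,
      ((R a).1 l₁ = (R b).1 l₂ ∧ l₁ = l₂) ∨ ((R a).1 l₁ = l₂ ∧ (R b).1 l₂ = l₁) → (R a).2 l₁ ≤ (R b).2 l₂) →
      (∀ a b : Fin (n + 1), a < b → (R a).1 = 1 → ∀ i j : Fin 3, i ≠ j → (R b).1 = Equiv.swap i j → (R b).2 i = (R b).2 j →
      G ((R a).2 i) + G ((R a).2 j) < 2 * G ((R b).2 i)) →
      (∀ a b : Fin (n + 1), a < b → (R b).1 = 1 → ∀ i j : Fin 3, i ≠ j → (R a).1 = Equiv.swap i j → (R a).2 i = (R a).2 j →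
      2 * G ((R a).2 i) < G ((R b).2 i) + G ((R b).2 j)) →
      (∀ a b : Fin (n + 1), a < b → ∀ i j k : Fin 3, i ≠ j → k ≠ i → k ≠ j → (R a).1 = Equiv.swap i j →
      (R a).2 i = (R a).2 j → (R b).1 i = j → (R b).1 j = k → (R b).1 k = i →
      G ((R a).2 k) + G ((R a).2 i) < G ((R b).2 j) + G ((R b).2 k)) →
      (∀ a b : Fin (n + 1), a < b → ∀ i j k : Fin 3, i ≠ j → k ≠ i → k ≠ j → (R a).1 i = j → (R a).1 j = k → (R a).1 k = i →
      (R b).1 = Equiv.swap i j → (R b).2 i = (R b).2 j → G ((R a).2 j) + G ((R a).2 k) < G ((R b).2 k) + G ((R b).2 i)) →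
      (∀ a b : Fin (n + 1), a < b → (R a).1 = 1 → ∀ i j k : Fin 3, i ≠ j → k ≠ i → k ≠ j →
      (R b).1 i = j → (R b).1 j = k → (R b).1 k = i → G ((R a).2 i) + G ((R a).2 j) < 2 * G ((R b).2 i)) →
      (∀ a b : Fin (n + 1), a < b → (R b).1 = 1 → ∀ i j k : Fin 3, i ≠ j → k ≠ i → k ≠ j →
      (R a).1 i = j → (R a).1 j = k → (R a).1 k = i → 2 * G ((R a).2 i) < G ((R b).2 i) + G ((R b).2 j)) → False) : False := by
  have hmono' : Monotone (fun x : Fin 4 => g 0 + g 1 + g 2 + g 3 - g x.rev) := by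
    intro x y hxy
    exact Nat.sub_le_sub_left (hmono (Fin.rev_le_rev.mpr hxy)) _
  have hshape' : ∀ k : Fin (n + 1), (r k.rev).1 = 1 ∨
      (∃ i j : Fin 3, i < j ∧ (r k.rev).1 = Equiv.swap i j ∧ ((r k.rev).2 i).rev = ((r k.rev).2 j).rev) ∨ (∀ i, (r k.rev).1 i ≠ i) := by
    intro k
    rcases hshape k.rev with h1 | ⟨i, j, hij, hs, hcc⟩ | hC
    · exact Or.inl h1
    · exact Or.inr (Or.inl ⟨i, j, hij, hs, by rw [hcc]⟩)
    · exact Or.inr (Or.inr hC)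
  have hM' : ∀ a b : Fin (n + 1), a < b → ∀ l₁ l₂ : Fin 3,
      ((r a.rev).1 l₁ = (r b.rev).1 l₂ ∧ l₁ = l₂) ∨ ((r a.rev).1 l₁ = l₂ ∧ (r b.rev).1 l₂ = l₁) →
      ((r a.rev).2 l₁).rev ≤ ((r b.rev).2 l₂).rev := by
    intro a b hab l₁ l₂ hcell
    apply Fin.rev_le_rev.mpr
    apply hM b.rev a.rev (Fin.rev_lt_rev.mpr hab) l₂ l₁
    rcases hcell with ⟨h1, h2⟩ | ⟨h1, h2⟩
    · exact Or.inl ⟨h1.symm, h2.symm⟩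
    · exact Or.inr ⟨h2, h1⟩
  have hR1a : ∀ a b : Fin (n + 1), a < b → (r a.rev).1 = 1 → ∀ i j : Fin 3, i ≠ j → (r b.rev).1 = Equiv.swap i j →
      ((r b.rev).2 i).rev = ((r b.rev).2 j).rev →
      (g 0 + g 1 + g 2 + g 3 - g ((r a.rev).2 i).rev.rev) + (g 0 + g 1 + g 2 + g 3 - g ((r a.rev).2 j).rev.rev) < 2 * (g 0 + g 1 + g 2 + g 3 - g ((r b.rev).2 i).rev.rev) := by
    intro a b hab ha1 i j hij hb1 hcc
    simp only [Fin.rev_rev]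
    have hC := hR1' b.rev a.rev (Fin.rev_lt_rev.mpr hab) ha1 i j hij hb1 (Fin.rev_injective hcc)
    have := g_le_total g ((r a.rev).2 i)
    have := g_le_total g ((r a.rev).2 j)
    have := g_le_total g ((r b.rev).2 i)
    omega
  have hR1b : ∀ a b : Fin (n + 1), a < b → (r b.rev).1 = 1 → ∀ i j : Fin 3, i ≠ j → (r a.rev).1 = Equiv.swap i j →
      ((r a.rev).2 i).rev = ((r a.rev).2 j).rev →
      2 * (g 0 + g 1 + g 2 + g 3 - g ((r a.rev).2 i).rev.rev) < (g 0 + g 1 + g 2 + g 3 - g ((r b.rev).2 i).rev.rev) + (g 0 + g 1 + g 2 + g 3 - g ((r b.rev).2 j).rev.rev) := by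
    intro a b hab hb1 i j hij ha1 hcc
    simp only [Fin.rev_rev]
    have hC := hR1 b.rev a.rev (Fin.rev_lt_rev.mpr hab) hb1 i j hij ha1 (Fin.rev_injective hcc)
    have := g_le_total g ((r a.rev).2 i)
    have := g_le_total g ((r b.rev).2 i)
    have := g_le_total g ((r b.rev).2 j)
    omega
  have hR2a : ∀ a b : Fin (n + 1), a < b → ∀ i j k : Fin 3, i ≠ j → k ≠ i → k ≠ j → (r a.rev).1 = Equiv.swap i j →
      ((r a.rev).2 i).rev = ((r a.rev).2 j).rev → (r b.rev).1 i = j → (r b.rev).1 j = k → (r b.rev).1 k = i →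
      (g 0 + g 1 + g 2 + g 3 - g ((r a.rev).2 k).rev.rev) + (g 0 + g 1 + g 2 + g 3 - g ((r a.rev).2 i).rev.rev) <
        (g 0 + g 1 + g 2 + g 3 - g ((r b.rev).2 j).rev.rev) + (g 0 + g 1 + g 2 + g 3 - g ((r b.rev).2 k).rev.rev) := by
    intro a b hab i j k hij hki hkj ha1 hcc hbi hbj hbk
    simp only [Fin.rev_rev]
    have hC := hR2' b.rev a.rev (Fin.rev_lt_rev.mpr hab) i j k hij hki hkj hbi hbj hbk ha1 (Fin.rev_injective hcc)
    have := g_le_total g ((r a.rev).2 k)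
    have := g_le_total g ((r a.rev).2 i)
    have := g_le_total g ((r b.rev).2 j)
    have := g_le_total g ((r b.rev).2 k)
    omega
  have hR2b : ∀ a b : Fin (n + 1), a < b → ∀ i j k : Fin 3, i ≠ j → k ≠ i → k ≠ j → (r a.rev).1 i = j → (r a.rev).1 j = k →
      (r a.rev).1 k = i → (r b.rev).1 = Equiv.swap i j → ((r b.rev).2 i).rev = ((r b.rev).2 j).rev →
      (g 0 + g 1 + g 2 + g 3 - g ((r a.rev).2 j).rev.rev) + (g 0 + g 1 + g 2 + g 3 - g ((r a.rev).2 k).rev.rev) <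
        (g 0 + g 1 + g 2 + g 3 - g ((r b.rev).2 k).rev.rev) + (g 0 + g 1 + g 2 + g 3 - g ((r b.rev).2 i).rev.rev) := by
    intro a b hab i j k hij hki hkj hai haj hak hb1 hcc
    simp only [Fin.rev_rev]
    have hC := hR2 b.rev a.rev (Fin.rev_lt_rev.mpr hab) i j k hij hki hkj hb1 (Fin.rev_injective hcc) hai haj hak
    have := g_le_total g ((r a.rev).2 j)
    have := g_le_total g ((r a.rev).2 k)
    have := g_le_total g ((r b.rev).2 k)
    have := g_le_total g ((r b.rev).2 i)
    omega
  have hR3a : ∀ a b : Fin (n + 1), a < b → (r a.rev).1 = 1 → ∀ i j k : Fin 3, i ≠ j → k ≠ i → k ≠ j →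
      (r b.rev).1 i = j → (r b.rev).1 j = k → (r b.rev).1 k = i →
      (g 0 + g 1 + g 2 + g 3 - g ((r a.rev).2 i).rev.rev) + (g 0 + g 1 + g 2 + g 3 - g ((r a.rev).2 j).rev.rev) < 2 * (g 0 + g 1 + g 2 + g 3 - g ((r b.rev).2 i).rev.rev) := by
    intro a b hab ha1 i j k hij hki hkj hbi hbj hbk
    simp only [Fin.rev_rev]
    have hC := hR3' b.rev a.rev (Fin.rev_lt_rev.mpr hab) ha1 i j k hij hki hkj hbi hbj hbk
    have := g_le_total g ((r a.rev).2 i)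
    have := g_le_total g ((r a.rev).2 j)
    have := g_le_total g ((r b.rev).2 i)
    omega
  have hR3b : ∀ a b : Fin (n + 1), a < b → (r b.rev).1 = 1 → ∀ i j k : Fin 3, i ≠ j → k ≠ i → k ≠ j →
      (r a.rev).1 i = j → (r a.rev).1 j = k → (r a.rev).1 k = i →
      2 * (g 0 + g 1 + g 2 + g 3 - g ((r a.rev).2 i).rev.rev) < (g 0 + g 1 + g 2 + g 3 - g ((r b.rev).2 i).rev.rev) + (g 0 + g 1 + g 2 + g 3 - g ((r b.rev).2 j).rev.rev) := by
    intro a b hab hb1 i j k hij hki hkj hai haj hak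
    simp only [Fin.rev_rev]
    have hC := hR3 b.rev a.rev (Fin.rev_lt_rev.mpr hab) hb1 i j k hij hki hkj hai haj hak
    have := g_le_total g ((r a.rev).2 i)
    have := g_le_total g ((r b.rev).2 i)
    have := g_le_total g ((r b.rev).2 j)
    omega
  exact h (fun k => ((r k.rev).1, fun i => ((r k.rev).2 i).rev)) (fun x => g 0 + g 1 + g 2 + g 3 - g x.rev) (fun _ => rfl) hmono'
    hshape' hM' hR1a hR1b hR2a hR2b hR3a hR3b

/-- **CORE (face-free), orbit model, seventeen.**  Under the orbit-chain hypotheses with pairwise distinct rank multisets, `n ≤ 17`: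
nineteen of the twenty multisets cannot be carried — whichever one is missed, one of the cores `orbY`, `orbV2`, mirrored `orbV2`, `core5`,
mirrored `core5` is carried in full. [counting + the five cores] -/
theorem core17 (n : ℕ) (r : Fin (n + 1) → Equiv.Perm (Fin 3) × (Fin 3 → Fin 4)) (g : Fin 4 → ℕ) (hmono : Monotone g)
    (hshape : ∀ k, (r k).1 = 1 ∨ (∃ i j : Fin 3, i < j ∧ (r k).1 = Equiv.swap i j ∧ (r k).2 i = (r k).2 j) ∨ (∀ i, (r k).1 i ≠ i))
    (hM : ∀ a b : Fin (n + 1), a < b → ∀ l₁ l₂ : Fin 3,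
      ((r a).1 l₁ = (r b).1 l₂ ∧ l₁ = l₂) ∨ ((r a).1 l₁ = l₂ ∧ (r b).1 l₂ = l₁) → (r a).2 l₁ ≤ (r b).2 l₂)
    (h3 : Function.Injective fun k => TropicalCensus.classSym (r k))
    (hR1 : ∀ a b : Fin (n + 1), a < b → (r a).1 = 1 → ∀ i j : Fin 3, i ≠ j → (r b).1 = Equiv.swap i j → (r b).2 i = (r b).2 j →
      g ((r a).2 i) + g ((r a).2 j) < 2 * g ((r b).2 i))
    (hR1' : ∀ a b : Fin (n + 1), a < b → (r b).1 = 1 → ∀ i j : Fin 3, i ≠ j → (r a).1 = Equiv.swap i j → (r a).2 i = (r a).2 j →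
      2 * g ((r a).2 i) < g ((r b).2 i) + g ((r b).2 j))
    (hR2 : ∀ a b : Fin (n + 1), a < b → ∀ i j k : Fin 3, i ≠ j → k ≠ i → k ≠ j → (r a).1 = Equiv.swap i j →
      (r a).2 i = (r a).2 j → (r b).1 i = j → (r b).1 j = k → (r b).1 k = i →
      g ((r a).2 k) + g ((r a).2 i) < g ((r b).2 j) + g ((r b).2 k))
    (hR2' : ∀ a b : Fin (n + 1), a < b → ∀ i j k : Fin 3, i ≠ j → k ≠ i → k ≠ j → (r a).1 i = j → (r a).1 j = k → (r a).1 k = i →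
      (r b).1 = Equiv.swap i j → (r b).2 i = (r b).2 j → g ((r a).2 j) + g ((r a).2 k) < g ((r b).2 k) + g ((r b).2 i))
    (hR3 : ∀ a b : Fin (n + 1), a < b → (r a).1 = 1 → ∀ i j k : Fin 3, i ≠ j → k ≠ i → k ≠ j →
      (r b).1 i = j → (r b).1 j = k → (r b).1 k = i → g ((r a).2 i) + g ((r a).2 j) < 2 * g ((r b).2 i))
    (hR3' : ∀ a b : Fin (n + 1), a < b → (r b).1 = 1 → ∀ i j k : Fin 3, i ≠ j → k ≠ i → k ≠ j →
      (r a).1 i = j → (r a).1 j = k → (r a).1 k = i → 2 * g ((r a).2 i) < g ((r b).2 i) + g ((r b).2 j)) : n ≤ 17 := by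
  by_contra hn
  rw [not_le] at hn
  -- two missed multisets contradict injectivity (`20 - 2 < n + 1`)
  have hmiss2 : ∀ w₁ w₂ : Fin 3 → Fin 4,
      TropicalCensus.classSym ((1 : Equiv.Perm (Fin 3)), w₁) ≠ TropicalCensus.classSym ((1 : Equiv.Perm (Fin 3)), w₂) →
      (∀ k, TropicalCensus.classSym (r k) ≠ TropicalCensus.classSym ((1 : Equiv.Perm (Fin 3)), w₁)) →
      (∀ k, TropicalCensus.classSym (r k) ≠ TropicalCensus.classSym ((1 : Equiv.Perm (Fin 3)), w₂)) → False := by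
    intro w₁ w₂ hne h₁ h₂
    have hsub : univ.image (fun k => TropicalCensus.classSym (r k)) ⊆
        (univ.erase (TropicalCensus.classSym ((1 : Equiv.Perm (Fin 3)), w₁))).erase
          (TropicalCensus.classSym ((1 : Equiv.Perm (Fin 3)), w₂)) := by
      intro M hM'
      rw [mem_image] at hM'
      obtain ⟨k, -, rfl⟩ := hM'
      rw [mem_erase, mem_erase]
      exact ⟨h₂ k, h₁ k, mem_univ _⟩
    have hcard := card_le_card hsub
    rw [card_image_of_injective _ h3, card_univ, Fintype.card_fin,
      card_erase_of_mem (by rw [mem_erase]; exact ⟨hne.symm, mem_univ _⟩), card_erase_of_mem (mem_univ _), card_univ,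
      Sym.card_sym_eq_multichoose, Fintype.card_fin] at hcard
    have h20 : Nat.multichoose 4 3 = 20 := by rw [Nat.multichoose_eq]; rfl
    omega
  have get : ∀ w₁ w₂ : Fin 3 → Fin 4,
      TropicalCensus.classSym ((1 : Equiv.Perm (Fin 3)), w₁) ≠ TropicalCensus.classSym ((1 : Equiv.Perm (Fin 3)), w₂) →
      (∀ k, TropicalCensus.classSym (r k) ≠ TropicalCensus.classSym ((1 : Equiv.Perm (Fin 3)), w₁)) →
      ∃ k, TropicalCensus.classSym (r k) = TropicalCensus.classSym ((1 : Equiv.Perm (Fin 3)), w₂) := by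
    intro w₁ w₂ hne h₁
    by_contra hno
    push Not at hno
    exact hmiss2 w₁ w₂ hne h₁ hno
  by_cases h013 : ∃ a, TropicalCensus.classSym (r a) = TropicalCensus.classSym ((1 : Equiv.Perm (Fin 3)), (![0, 1, 3] : Fin 3 → Fin 4))
  · obtain ⟨a, ha⟩ := h013
    by_cases h023 : ∃ b, TropicalCensus.classSym (r b) = TropicalCensus.classSym ((1 : Equiv.Perm (Fin 3)), (![0, 2, 3] : Fin 3 → Fin 4))
    · obtain ⟨b, hb⟩ := h023
      by_cases h112 : ∃ c, TropicalCensus.classSym (r c) = TropicalCensus.classSym ((1 : Equiv.Perm (Fin 3)), (![1, 1, 2] : Fin 3 → Fin 4))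
      · obtain ⟨c, hc⟩ := h112
        by_cases h122 : ∃ e, TropicalCensus.classSym (r e) =
            TropicalCensus.classSym ((1 : Equiv.Perm (Fin 3)), (![1, 2, 2] : Fin 3 → Fin 4))
        · obtain ⟨e, he⟩ := h122
          exact orbY r g hmono hshape hM hR1 hR1' hR2 hR2' hR3 hR3' a b c e ha hb hc he
        · -- `{1,2,2}` missed: the mirrored chain carries the five-class core
          push Not at h122
          obtain ⟨f, hf⟩ := get _ ![0, 2, 2] (by decide) h122
          obtain ⟨q, hq⟩ := get _ ![1, 1, 1] (by decide) h122
          refine mirror_elim r g hmono hshape hM hR1 hR1' hR2 hR2' hR3 hR3' fun R G hR hmonoG hshR hMR h1R h1R' h2R h2R' h3R h3R' => ?_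
          have ka := hit_mirror r ![0, 1, 3] ![0, 2, 3] (by decide) hb
          have kb := hit_mirror r ![0, 2, 3] ![0, 1, 3] (by decide) ha
          have kf := hit_mirror r ![1, 1, 3] ![0, 2, 2] (by decide) hf
          have ke := hit_mirror r ![1, 2, 2] ![1, 1, 2] (by decide) hc
          have kq := hit_mirror r ![2, 2, 2] ![1, 1, 1] (by decide) hq
          rw [← hR] at ka kb kf ke kq
          exact core5 R G hmonoG hshR hMR h1R h1R' h2R h2R' h3R h3R' b.rev a.rev f.rev c.rev q.rev ka kb kf ke kq
      · -- `{1,1,2}` missed: the five-class core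
        push Not at h112
        obtain ⟨f, hf⟩ := get _ ![1, 1, 3] (by decide) h112
        obtain ⟨e, he⟩ := get _ ![1, 2, 2] (by decide) h112
        obtain ⟨q, hq⟩ := get _ ![2, 2, 2] (by decide) h112
        exact core5 r g hmono hshape hM hR1 hR1' hR2 hR2' hR3 hR3' a b f e q ha hb hf he hq
    · -- `{0,2,3}` missed: the mirrored chain carries the V2-core
      push Not at h023
      obtain ⟨z, hz⟩ := get _ ![0, 3, 3] (by decide) h023
      obtain ⟨c, hc⟩ := get _ ![1, 1, 2] (by decide) h023
      obtain ⟨e, he⟩ := get _ ![1, 2, 2] (by decide) h023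
      refine mirror_elim r g hmono hshape hM hR1 hR1' hR2 hR2' hR3 hR3' fun R G hR hmonoG hshR hMR h1R h1R' h2R h2R' h3R h3R' => ?_
      have kz := hit_mirror r ![0, 0, 3] ![0, 3, 3] (by decide) hz
      have kb := hit_mirror r ![0, 2, 3] ![0, 1, 3] (by decide) ha
      have kc := hit_mirror r ![1, 1, 2] ![1, 2, 2] (by decide) he
      have ke := hit_mirror r ![1, 2, 2] ![1, 1, 2] (by decide) hc
      rw [← hR] at kz kb kc ke
      exact orbV2 R G hmonoG hshR hMR h1R h1R' h2R h2R' h3R h3R' z.rev a.rev e.rev c.rev kz kb kc ke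
  · -- `{0,1,3}` missed: the V2-core
    push Not at h013
    obtain ⟨z, hz⟩ := get _ ![0, 0, 3] (by decide) h013
    obtain ⟨b, hb⟩ := get _ ![0, 2, 3] (by decide) h013
    obtain ⟨c, hc⟩ := get _ ![1, 1, 2] (by decide) h013
    obtain ⟨e, he⟩ := get _ ![1, 2, 2] (by decide) h013
    exact orbV2 r g hmono hshape hM hR1 hR1' hR2 hR2' hR3 hR3' z b c e hz hb hc he

end SymmetricOrbitThreeFour

open SymmetricOrbitThreeFour
open Summit.ValiantsHypothesis.ValiantsHypothesis.Theorems.LacunarySymmetroidMatrixDescartes.TropicalCensus.Orbit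

/-- **`T^orb_sym(3,4) ≤ 17` ON EVERY SUPPORT.**  A SYMMETRIC `3 × 3` dominance design with four slope classes has at most `17` sign-alternating
ORBIT-dominant breakpoints along increasing integer slopes (orbit model of the cell: a term beats every present term outside its transpose
orbit).  Face-free and sign-free: the five exclusion cores (`orbY`, `orbV2` and its mirror, `core5` and its mirror) show that two of the
twenty rank multisets are always missed.  Improves `tropRow_three_four_symmOrb_le_eighteen` (p498614); the cell's value «≤ 16»
(`TSymOrb34Le16`, needs a non-pairwise ingredient) remains open in the kernel. [cell statement R1732; folklore-level exchange arguments] -/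
theorem tropRow_three_four_symmOrb_le_seventeen (d : Fin 4 → ℕ) (v ε : Fin 3 → Fin 3 → Fin 4 → ℤ)
    (hv : ∀ i j l, v i j l = v j i l) (hεs : ∀ i j l, ε i j l = ε j i l)
    (n : ℕ) (θ : Fin (n + 1) → ℤ) (p : Fin (n + 1) → Equiv.Perm (Fin 3) × (Fin 3 → Fin 4))
    (hθ : StrictMono θ) (hdom : ∀ k, IsOrbitDominant d v ε (θ k) (p k))
    (halt : ∀ k : Fin n, termSign ε (p k.castSucc) * termSign ε (p k.succ) < 0) : n ≤ 17 :=
  SymmetricOrbitThreeFour.core17 n (fun k => ((p k).1, fun i => (Tuple.sort d).symm ((p k).2 i))) (d ∘ Tuple.sort d)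
    (Tuple.monotone_sort d)
    (fun k => orbitChain_shape d v ε hv hεs θ p hdom k)
    (fun a b hab l₁ l₂ hcell => orbitChain_M d v ε hv hεs θ p hθ hdom a b hab l₁ l₂ hcell)
    (orbitChain_injective d v ε hv hεs θ p hθ hdom halt)
    (fun a b hab ha1 _ _ hij hb1 hcc => orbitChain_R1 d v ε θ p hθ hdom a b hab ha1 hij hb1 hcc)
    (fun a b hab hb1 _ _ hij ha1 hcc => orbitChain_R1' d v ε θ p hθ hdom a b hab hb1 hij ha1 hcc)
    (fun a b hab _ _ _ hij hki hkj ha1 hcc hbi hbj hbk => orbitChain_R2 d v ε hv hεs θ p hθ hdom a b hab hij hki hkj ha1 hcc hbi hbj hbk)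
    (fun a b hab _ _ _ hij hki hkj hai haj hak hb1 hcc => orbitChain_R2' d v ε hv hεs θ p hθ hdom a b hab hij hki hkj hai haj hak hb1 hcc)
    (fun a b hab ha1 _ _ _ hij hki hkj hbi hbj hbk => orbitChain_R3 d v ε hv hεs θ p hθ hdom a b hab ha1 hij hki hkj hbi hbj hbk)
    (fun a b hab hb1 _ _ _ hij hki hkj hai haj hak => orbitChain_R3' d v ε hv hεs θ p hθ hdom a b hab hb1 hij hki hkj hai haj hak)

/-- **`TropRootLawAtSymmOrb 3 4 17`** — the kernel row of the ORBIT model at `(3,4)`, face-free and sign-free (target of record beyond it: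
`TSymOrb34Le16`, NOT asserted). [restatement] -/
theorem tropRootLawAtSymmOrb_three_four_seventeen : TropRootLawAtSymmOrb 3 4 17 :=
  fun d v ε hv hε n θ p hθ hdom halt => tropRow_three_four_symmOrb_le_seventeen d v ε hv hε n θ p hθ hdom halt

/-- **`TSymOrb34Le17` holds** («T^orb_sym(3,4) ≤ 17 on every support», words of R1732): the port target of
`KPlusLogSqLawTropicalOrbitDominance` discharged. [restatement] -/
theorem tSymOrb34Le17_holds : TSymOrb34Le17 :=
  tropRootLawAtSymmOrb_three_four_seventeen

end Summit.ValiantsHypothesis.ValiantsHypothesis.Theorems.KPlusLogSqLaw
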